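import Mathlib
import HarnessLib
import Summits.NavierStokesRegularity.NavierStokesRegularity.Theorems.SymmetryModuliCountForcedSymmetryRecurrentClosingNoSlack
import Summits.NavierStokesRegularity.NavierStokesRegularity.Theorems.RecurrentProfilesRecurrentReduction

/-!
# Crux `ForcedSymmetry` (stmt-NavierStokesRegularity-4052), line `recurrent-closing`:
# the open stub `RecurrentClosingWeak` is EXACTLY `RDSSLiouvilleInClass → X` — the weakest complement of stmt-8561

Route `SymmetryModuliCount`, sub-problem `NavierStokesRegularity`.  Lead seat c4 (2026-08-17), skeleton gen 4
(`Cruxes/ForcedSymmetry/Lines/recurrent_closing.lean`, stubs `stub_recurrentClosingWeak`, `stub_rdssLiouville` = stmt-8561).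

The no-slack certificate of lead c3 (`typeIAncientLiouville_iff_recurrentClosingWeak_and_rdssLiouville`) says
`X ↔ (RecurrentClosingWeak ∧ RDSSLiouvilleInClass)`.  This file pins down the open stub itself:

* `recurrentClosingWeak_iff_rdssLiouville_imp` — **`RecurrentClosingWeak ↔ (RDSSLiouvilleInClass → X)`**.  (`→` is the
  residual; `←` by cases: under `RDSSLiouvilleInClass` the right side gives `X`, which makes the stub vacuous; under
  `¬ RDSSLiouvilleInClass` the counterexample to stmt-8561 IS an RDSS singular profile of the class, i.e. a witness of
  the stub's conclusion — the stub never looks at its recurrent input.)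
* `recurrentClosingWeak_of_complement` — hence the stub is the WEAKEST possible partner of stmt-8561: every statement `S`
  with `S → RDSSLiouvilleInClass → X` already implies it.  No reshape of this line (or of any line through stmt-8561)
  can replace `stub_recurrentClosingWeak` by something logically weaker.
* `recurrentClosingWeak_iff_singularForcesRdss` — the Birkhoff recurrence hypothesis is logically idle (it is supplied
  by the landed `recurrentReduction_proof`, stmt-1590): the stub is equivalent to **`SingularForcesRdss`**: "a Type-I-rate
  profile of Albritton–Barker's slab class singular at the origin forces the existence of an RDSS profile of the class
  singular at the origin".  Recurrence remains available as a TOOL for a proof; it is not part of the CLAIM.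
* `recurrentClosingWeak_iff_rdssLiouville_imp_forcedSymmetry`, `singularForcesRdss_iff_rdssLiouville_imp_noTypeIRateProfile`
  — the same with the crux / with stmt-1588 on the right.

Consequence for the planners (census R6): promoting `stub_recurrentClosingWeak` to an item means filing the implication
"RDSS-Liouville in the class ⇒ Type-I Liouville" (`RDSSLiouvilleInClass → TypeIAncientLiouville`), in whichever of the
three equivalent phrasings is most attackable; its refutation target is a Type-I singular profile in a world where every
RDSS profile of the class is regular.

References: D. Albritton, T. Barker, J. Math. Fluid Mech. 21 (2019) = arXiv:1811.00502, Thm 1.1, Lemma 2.2, Prop. 2.3, §3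
[AlbrittonBarker2019]; H. Furstenberg, *Recurrence in Ergodic Theory and Combinatorial Number Theory* (1981), Thm. 1.16
[Furstenberg1981]; census `Cruxes/ForcedSymmetry/STRATEGY-CENSUS.md` §D5/R6.
-/

noncomputable section

-- the summit and its single problem share the name (D-0017 nested layout)
set_option linter.dupNamespace false

open MeasureTheory Set Function
open Literature.Analysis.FluidPDE
open Summit.NavierStokesRegularity.NavierStokesRegularity.Theses
open Summit.NavierStokesRegularity.NavierStokesRegularity.Theses.SymmetryModuliCount
open Summit.NavierStokesRegularity.NavierStokesRegularity.Theses.DulacContraction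

namespace Summit.NavierStokesRegularity.NavierStokesRegularity.Theorems.SymmetryModuliCountForcedSymmetry

/-- **`RecurrentClosingWeak ↔ (RDSSLiouvilleInClass → X)`.**  The open stub of the line `recurrent-closing` is exactly the
statement that RDSS-Liouville in Albritton–Barker's class (stmt-8561) suffices for Type-I Liouville (stmt-4050).  `→`:
the landed residual `typeIAncientLiouville_of_recurrentClosingWeak`.  `←`: if stmt-8561 holds, `X` holds and no profile of
the class is singular (`noTypeIRateProfile_of_typeIAncientLiouville`), so the stub is vacuous; if stmt-8561 fails, its
counterexample is an RDSS profile of the class singular at the origin — a witness of the stub's conclusion.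
[cite: AlbrittonBarker2019, Thm 1.1, §3] -/
theorem recurrentClosingWeak_iff_rdssLiouville_imp :
    (∀ (u : ℝ → EuclideanSpace ℝ (Fin 3) → EuclideanSpace ℝ (Fin 3)) (p : ℝ → EuclideanSpace ℝ (Fin 3) → ℝ)
        (G : ℝ → EuclideanSpace ℝ (Fin 3) → EuclideanSpace ℝ (Fin 3) →L[ℝ] EuclideanSpace ℝ (Fin 3)) (C : ℝ),
        IsSuitableWeakSolutionOn (slab (EuclideanSpace ℝ (Fin 3)) (Set.Iio 0) isOpen_Iio) 1 0 u p →
        HasWeakSpatialGradientOn (slab (EuclideanSpace ℝ (Fin 3)) (Set.Iio 0) isOpen_Iio) u G →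
        typeIBound (Set.Iio (0 : ℝ) ×ˢ Set.univ) u p G < ⊤ →
        HasTypeITimeDecay C u →
        (∀ ε : ℝ, 0 < ε → ∀ K : Set (ℝ × EuclideanSpace ℝ (Fin 3)), IsCompact K → K ⊆ Set.Iic (0 : ℝ) ×ˢ Set.univ →
          ∃ L : ℝ, 0 < L ∧ ∀ a : ℝ, ∃ σ ∈ Set.Icc a (a + L),
            eLpNorm (fun z : ℝ × EuclideanSpace ℝ (Fin 3) => nsRescale (Real.exp σ) u z.1 z.2 - u z.1 z.2) 3
              (volume.restrict K) ≤ ENNReal.ofReal ε) →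
        IsBackwardSingularPoint u 0 →
        ∃ (w : ℝ → EuclideanSpace ℝ (Fin 3) → EuclideanSpace ℝ (Fin 3)) (q : ℝ → EuclideanSpace ℝ (Fin 3) → ℝ)
          (H : ℝ → EuclideanSpace ℝ (Fin 3) → EuclideanSpace ℝ (Fin 3) →L[ℝ] EuclideanSpace ℝ (Fin 3)) (C' : ℝ),
          IsSuitableWeakSolutionOn (slab (EuclideanSpace ℝ (Fin 3)) (Set.Iio 0) isOpen_Iio) 1 0 w q ∧
          HasWeakSpatialGradientOn (slab (EuclideanSpace ℝ (Fin 3)) (Set.Iio 0) isOpen_Iio) w H ∧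
          typeIBound (Set.Iio (0 : ℝ) ×ˢ Set.univ) w q H < ⊤ ∧
          HasTypeITimeDecay C' w ∧
          (∃ l : ℝ, 1 < l ∧ ∃ (R : EuclideanSpace ℝ (Fin 3) ≃ₗᵢ[ℝ] EuclideanSpace ℝ (Fin 3))
              (ξ : EuclideanSpace ℝ (Fin 3)) (τ : ℝ), τ ≤ 0 ∧
              (fun z : ℝ × EuclideanSpace ℝ (Fin 3) => l • R.symm (w (l ^ 2 * z.1 + τ) (l • R z.2 + ξ)))
                =ᵐ[volume.restrict (Set.Iio (0 : ℝ) ×ˢ Set.univ)]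
              (fun z : ℝ × EuclideanSpace ℝ (Fin 3) => w z.1 z.2)) ∧
          IsBackwardSingularPoint w 0) ↔
      (RDSSLiouvilleInClass → TypeIAncientLiouville) := by
  constructor
  · intro hW hR
    exact typeIAncientLiouville_of_recurrentClosingWeak hW hR
  · intro h u p G C hsw hwg hI hdec _hrec hsing
    by_cases hR : RDSSLiouvilleInClass
    · exact absurd hsing (noTypeIRateProfile_of_typeIAncientLiouville (h hR) u p G C hsw hwg hI hdec)
    · -- the counterexample to stmt-8561 is the witness
      by_contra hne
      apply hR
      intro w q H C' h1 h2 h3 h4 _h5 h6 hs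
      exact hne ⟨w, q, H, C', h1, h2, h3, h4, h6, hs⟩

/-- **The stub is the weakest partner of stmt-8561.**  Any statement `S` that together with `RDSSLiouvilleInClass` yields
`X` already implies `RecurrentClosingWeak`; in particular no reshape of the line can trade the stub for a logically
weaker one. [cite: AlbrittonBarker2019, Thm 1.1, §3] -/
theorem recurrentClosingWeak_of_complement {S : Prop} (h : S → RDSSLiouvilleInClass → TypeIAncientLiouville) (hS : S) :
    ∀ (u : ℝ → EuclideanSpace ℝ (Fin 3) → EuclideanSpace ℝ (Fin 3)) (p : ℝ → EuclideanSpace ℝ (Fin 3) → ℝ)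
      (G : ℝ → EuclideanSpace ℝ (Fin 3) → EuclideanSpace ℝ (Fin 3) →L[ℝ] EuclideanSpace ℝ (Fin 3)) (C : ℝ),
      IsSuitableWeakSolutionOn (slab (EuclideanSpace ℝ (Fin 3)) (Set.Iio 0) isOpen_Iio) 1 0 u p →
      HasWeakSpatialGradientOn (slab (EuclideanSpace ℝ (Fin 3)) (Set.Iio 0) isOpen_Iio) u G →
      typeIBound (Set.Iio (0 : ℝ) ×ˢ Set.univ) u p G < ⊤ →
      HasTypeITimeDecay C u →
      (∀ ε : ℝ, 0 < ε → ∀ K : Set (ℝ × EuclideanSpace ℝ (Fin 3)), IsCompact K → K ⊆ Set.Iic (0 : ℝ) ×ˢ Set.univ →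
        ∃ L : ℝ, 0 < L ∧ ∀ a : ℝ, ∃ σ ∈ Set.Icc a (a + L),
          eLpNorm (fun z : ℝ × EuclideanSpace ℝ (Fin 3) => nsRescale (Real.exp σ) u z.1 z.2 - u z.1 z.2) 3
            (volume.restrict K) ≤ ENNReal.ofReal ε) →
      IsBackwardSingularPoint u 0 →
      ∃ (w : ℝ → EuclideanSpace ℝ (Fin 3) → EuclideanSpace ℝ (Fin 3)) (q : ℝ → EuclideanSpace ℝ (Fin 3) → ℝ)
        (H : ℝ → EuclideanSpace ℝ (Fin 3) → EuclideanSpace ℝ (Fin 3) →L[ℝ] EuclideanSpace ℝ (Fin 3)) (C' : ℝ),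
        IsSuitableWeakSolutionOn (slab (EuclideanSpace ℝ (Fin 3)) (Set.Iio 0) isOpen_Iio) 1 0 w q ∧
        HasWeakSpatialGradientOn (slab (EuclideanSpace ℝ (Fin 3)) (Set.Iio 0) isOpen_Iio) w H ∧
        typeIBound (Set.Iio (0 : ℝ) ×ˢ Set.univ) w q H < ⊤ ∧
        HasTypeITimeDecay C' w ∧
        (∃ l : ℝ, 1 < l ∧ ∃ (R : EuclideanSpace ℝ (Fin 3) ≃ₗᵢ[ℝ] EuclideanSpace ℝ (Fin 3))
            (ξ : EuclideanSpace ℝ (Fin 3)) (τ : ℝ), τ ≤ 0 ∧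
            (fun z : ℝ × EuclideanSpace ℝ (Fin 3) => l • R.symm (w (l ^ 2 * z.1 + τ) (l • R z.2 + ξ)))
              =ᵐ[volume.restrict (Set.Iio (0 : ℝ) ×ˢ Set.univ)]
            (fun z : ℝ × EuclideanSpace ℝ (Fin 3) => w z.1 z.2)) ∧
        IsBackwardSingularPoint w 0 :=
  recurrentClosingWeak_iff_rdssLiouville_imp.2 (h hS)

/-- **`RecurrentClosingWeak ↔ (RDSSLiouvilleInClass → ForcedSymmetry)`**: the same with the crux on the right
(`forcedSymmetry_iff_typeIAncientLiouville`). [cite: AlbrittonBarker2019, Thm 1.1, §3] -/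
theorem recurrentClosingWeak_iff_rdssLiouville_imp_forcedSymmetry :
    (∀ (u : ℝ → EuclideanSpace ℝ (Fin 3) → EuclideanSpace ℝ (Fin 3)) (p : ℝ → EuclideanSpace ℝ (Fin 3) → ℝ)
        (G : ℝ → EuclideanSpace ℝ (Fin 3) → EuclideanSpace ℝ (Fin 3) →L[ℝ] EuclideanSpace ℝ (Fin 3)) (C : ℝ),
        IsSuitableWeakSolutionOn (slab (EuclideanSpace ℝ (Fin 3)) (Set.Iio 0) isOpen_Iio) 1 0 u p →
        HasWeakSpatialGradientOn (slab (EuclideanSpace ℝ (Fin 3)) (Set.Iio 0) isOpen_Iio) u G →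
        typeIBound (Set.Iio (0 : ℝ) ×ˢ Set.univ) u p G < ⊤ →
        HasTypeITimeDecay C u →
        (∀ ε : ℝ, 0 < ε → ∀ K : Set (ℝ × EuclideanSpace ℝ (Fin 3)), IsCompact K → K ⊆ Set.Iic (0 : ℝ) ×ˢ Set.univ →
          ∃ L : ℝ, 0 < L ∧ ∀ a : ℝ, ∃ σ ∈ Set.Icc a (a + L),
            eLpNorm (fun z : ℝ × EuclideanSpace ℝ (Fin 3) => nsRescale (Real.exp σ) u z.1 z.2 - u z.1 z.2) 3
              (volume.restrict K) ≤ ENNReal.ofReal ε) →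
        IsBackwardSingularPoint u 0 →
        ∃ (w : ℝ → EuclideanSpace ℝ (Fin 3) → EuclideanSpace ℝ (Fin 3)) (q : ℝ → EuclideanSpace ℝ (Fin 3) → ℝ)
          (H : ℝ → EuclideanSpace ℝ (Fin 3) → EuclideanSpace ℝ (Fin 3) →L[ℝ] EuclideanSpace ℝ (Fin 3)) (C' : ℝ),
          IsSuitableWeakSolutionOn (slab (EuclideanSpace ℝ (Fin 3)) (Set.Iio 0) isOpen_Iio) 1 0 w q ∧
          HasWeakSpatialGradientOn (slab (EuclideanSpace ℝ (Fin 3)) (Set.Iio 0) isOpen_Iio) w H ∧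
          typeIBound (Set.Iio (0 : ℝ) ×ˢ Set.univ) w q H < ⊤ ∧
          HasTypeITimeDecay C' w ∧
          (∃ l : ℝ, 1 < l ∧ ∃ (R : EuclideanSpace ℝ (Fin 3) ≃ₗᵢ[ℝ] EuclideanSpace ℝ (Fin 3))
              (ξ : EuclideanSpace ℝ (Fin 3)) (τ : ℝ), τ ≤ 0 ∧
              (fun z : ℝ × EuclideanSpace ℝ (Fin 3) => l • R.symm (w (l ^ 2 * z.1 + τ) (l • R z.2 + ξ)))
                =ᵐ[volume.restrict (Set.Iio (0 : ℝ) ×ˢ Set.univ)]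
              (fun z : ℝ × EuclideanSpace ℝ (Fin 3) => w z.1 z.2)) ∧
          IsBackwardSingularPoint w 0) ↔
      (RDSSLiouvilleInClass → ForcedSymmetry) :=
  recurrentClosingWeak_iff_rdssLiouville_imp.trans
    (imp_congr_right fun _ => forcedSymmetry_iff_typeIAncientLiouville.symm)

/-- **The recurrence hypothesis is logically idle: `RecurrentClosingWeak ↔ SingularForcesRdss`.**  The stub is equivalent
to its recurrence-free form "a Type-I-rate profile of the slab class singular at the origin forces an RDSS profile of the
class singular at the origin": `←` forgets the recurrence clause, `→` first passes to a uniformly recurrent singular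
profile of the same class by the landed `recurrentReduction_proof` (stmt-1590, Birkhoff–Furstenberg in Albritton–Barker's
compact class). [cite: AlbrittonBarker2019, Lemma 2.2, Prop. 2.3; Furstenberg1981, Thm. 1.16] -/
theorem recurrentClosingWeak_iff_singularForcesRdss :
    (∀ (u : ℝ → EuclideanSpace ℝ (Fin 3) → EuclideanSpace ℝ (Fin 3)) (p : ℝ → EuclideanSpace ℝ (Fin 3) → ℝ)
        (G : ℝ → EuclideanSpace ℝ (Fin 3) → EuclideanSpace ℝ (Fin 3) →L[ℝ] EuclideanSpace ℝ (Fin 3)) (C : ℝ),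
        IsSuitableWeakSolutionOn (slab (EuclideanSpace ℝ (Fin 3)) (Set.Iio 0) isOpen_Iio) 1 0 u p →
        HasWeakSpatialGradientOn (slab (EuclideanSpace ℝ (Fin 3)) (Set.Iio 0) isOpen_Iio) u G →
        typeIBound (Set.Iio (0 : ℝ) ×ˢ Set.univ) u p G < ⊤ →
        HasTypeITimeDecay C u →
        (∀ ε : ℝ, 0 < ε → ∀ K : Set (ℝ × EuclideanSpace ℝ (Fin 3)), IsCompact K → K ⊆ Set.Iic (0 : ℝ) ×ˢ Set.univ →
          ∃ L : ℝ, 0 < L ∧ ∀ a : ℝ, ∃ σ ∈ Set.Icc a (a + L),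
            eLpNorm (fun z : ℝ × EuclideanSpace ℝ (Fin 3) => nsRescale (Real.exp σ) u z.1 z.2 - u z.1 z.2) 3
              (volume.restrict K) ≤ ENNReal.ofReal ε) →
        IsBackwardSingularPoint u 0 →
        ∃ (w : ℝ → EuclideanSpace ℝ (Fin 3) → EuclideanSpace ℝ (Fin 3)) (q : ℝ → EuclideanSpace ℝ (Fin 3) → ℝ)
          (H : ℝ → EuclideanSpace ℝ (Fin 3) → EuclideanSpace ℝ (Fin 3) →L[ℝ] EuclideanSpace ℝ (Fin 3)) (C' : ℝ),
          IsSuitableWeakSolutionOn (slab (EuclideanSpace ℝ (Fin 3)) (Set.Iio 0) isOpen_Iio) 1 0 w q ∧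
          HasWeakSpatialGradientOn (slab (EuclideanSpace ℝ (Fin 3)) (Set.Iio 0) isOpen_Iio) w H ∧
          typeIBound (Set.Iio (0 : ℝ) ×ˢ Set.univ) w q H < ⊤ ∧
          HasTypeITimeDecay C' w ∧
          (∃ l : ℝ, 1 < l ∧ ∃ (R : EuclideanSpace ℝ (Fin 3) ≃ₗᵢ[ℝ] EuclideanSpace ℝ (Fin 3))
              (ξ : EuclideanSpace ℝ (Fin 3)) (τ : ℝ), τ ≤ 0 ∧
              (fun z : ℝ × EuclideanSpace ℝ (Fin 3) => l • R.symm (w (l ^ 2 * z.1 + τ) (l • R z.2 + ξ)))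
                =ᵐ[volume.restrict (Set.Iio (0 : ℝ) ×ˢ Set.univ)]
              (fun z : ℝ × EuclideanSpace ℝ (Fin 3) => w z.1 z.2)) ∧
          IsBackwardSingularPoint w 0) ↔
      (∀ (u : ℝ → EuclideanSpace ℝ (Fin 3) → EuclideanSpace ℝ (Fin 3)) (p : ℝ → EuclideanSpace ℝ (Fin 3) → ℝ)
        (G : ℝ → EuclideanSpace ℝ (Fin 3) → EuclideanSpace ℝ (Fin 3) →L[ℝ] EuclideanSpace ℝ (Fin 3)) (C : ℝ),
        IsSuitableWeakSolutionOn (slab (EuclideanSpace ℝ (Fin 3)) (Set.Iio 0) isOpen_Iio) 1 0 u p →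
        HasWeakSpatialGradientOn (slab (EuclideanSpace ℝ (Fin 3)) (Set.Iio 0) isOpen_Iio) u G →
        typeIBound (Set.Iio (0 : ℝ) ×ˢ Set.univ) u p G < ⊤ →
        HasTypeITimeDecay C u →
        IsBackwardSingularPoint u 0 →
        ∃ (w : ℝ → EuclideanSpace ℝ (Fin 3) → EuclideanSpace ℝ (Fin 3)) (q : ℝ → EuclideanSpace ℝ (Fin 3) → ℝ)
          (H : ℝ → EuclideanSpace ℝ (Fin 3) → EuclideanSpace ℝ (Fin 3) →L[ℝ] EuclideanSpace ℝ (Fin 3)) (C' : ℝ),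
          IsSuitableWeakSolutionOn (slab (EuclideanSpace ℝ (Fin 3)) (Set.Iio 0) isOpen_Iio) 1 0 w q ∧
          HasWeakSpatialGradientOn (slab (EuclideanSpace ℝ (Fin 3)) (Set.Iio 0) isOpen_Iio) w H ∧
          typeIBound (Set.Iio (0 : ℝ) ×ˢ Set.univ) w q H < ⊤ ∧
          HasTypeITimeDecay C' w ∧
          (∃ l : ℝ, 1 < l ∧ ∃ (R : EuclideanSpace ℝ (Fin 3) ≃ₗᵢ[ℝ] EuclideanSpace ℝ (Fin 3))
              (ξ : EuclideanSpace ℝ (Fin 3)) (τ : ℝ), τ ≤ 0 ∧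
              (fun z : ℝ × EuclideanSpace ℝ (Fin 3) => l • R.symm (w (l ^ 2 * z.1 + τ) (l • R z.2 + ξ)))
                =ᵐ[volume.restrict (Set.Iio (0 : ℝ) ×ˢ Set.univ)]
              (fun z : ℝ × EuclideanSpace ℝ (Fin 3) => w z.1 z.2)) ∧
          IsBackwardSingularPoint w 0) := by
  constructor
  · intro hW u p G C hsw hwg hI hdec hsing
    obtain ⟨w₁, q₁, H₁, hw₁, hG₁, hI₁, hC₁, hsing₁, hrec₁⟩ :=
      Summit.NavierStokesRegularity.NavierStokesRegularity.Theorems.recurrentReduction_proof u p G C hsw hwg hI hdec hsing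
    exact hW w₁ q₁ H₁ C hw₁ hG₁ hI₁ hC₁ hrec₁ hsing₁
  · intro h u p G C hsw hwg hI hdec _hrec hsing
    exact h u p G C hsw hwg hI hdec hsing

/-- **`SingularForcesRdss ↔ (RDSSLiouvilleInClass → NoTypeIRateProfile)`** (stmt-8561 ⇒ stmt-1588 form): the
recurrence-free stub against the slab-class Liouville statement, through `typeIAncientLiouville_iff_noTypeIRateProfile`.
[cite: AlbrittonBarker2019, Thm 1.1, §3] -/
theorem singularForcesRdss_iff_rdssLiouville_imp_noTypeIRateProfile :
    (∀ (u : ℝ → EuclideanSpace ℝ (Fin 3) → EuclideanSpace ℝ (Fin 3)) (p : ℝ → EuclideanSpace ℝ (Fin 3) → ℝ)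
        (G : ℝ → EuclideanSpace ℝ (Fin 3) → EuclideanSpace ℝ (Fin 3) →L[ℝ] EuclideanSpace ℝ (Fin 3)) (C : ℝ),
        IsSuitableWeakSolutionOn (slab (EuclideanSpace ℝ (Fin 3)) (Set.Iio 0) isOpen_Iio) 1 0 u p →
        HasWeakSpatialGradientOn (slab (EuclideanSpace ℝ (Fin 3)) (Set.Iio 0) isOpen_Iio) u G →
        typeIBound (Set.Iio (0 : ℝ) ×ˢ Set.univ) u p G < ⊤ →
        HasTypeITimeDecay C u →
        IsBackwardSingularPoint u 0 →
        ∃ (w : ℝ → EuclideanSpace ℝ (Fin 3) → EuclideanSpace ℝ (Fin 3)) (q : ℝ → EuclideanSpace ℝ (Fin 3) → ℝ)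
          (H : ℝ → EuclideanSpace ℝ (Fin 3) → EuclideanSpace ℝ (Fin 3) →L[ℝ] EuclideanSpace ℝ (Fin 3)) (C' : ℝ),
          IsSuitableWeakSolutionOn (slab (EuclideanSpace ℝ (Fin 3)) (Set.Iio 0) isOpen_Iio) 1 0 w q ∧
          HasWeakSpatialGradientOn (slab (EuclideanSpace ℝ (Fin 3)) (Set.Iio 0) isOpen_Iio) w H ∧
          typeIBound (Set.Iio (0 : ℝ) ×ˢ Set.univ) w q H < ⊤ ∧
          HasTypeITimeDecay C' w ∧
          (∃ l : ℝ, 1 < l ∧ ∃ (R : EuclideanSpace ℝ (Fin 3) ≃ₗᵢ[ℝ] EuclideanSpace ℝ (Fin 3))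
              (ξ : EuclideanSpace ℝ (Fin 3)) (τ : ℝ), τ ≤ 0 ∧
              (fun z : ℝ × EuclideanSpace ℝ (Fin 3) => l • R.symm (w (l ^ 2 * z.1 + τ) (l • R z.2 + ξ)))
                =ᵐ[volume.restrict (Set.Iio (0 : ℝ) ×ˢ Set.univ)]
              (fun z : ℝ × EuclideanSpace ℝ (Fin 3) => w z.1 z.2)) ∧
          IsBackwardSingularPoint w 0) ↔
      (RDSSLiouvilleInClass → RecurrentProfiles.NoTypeIRateProfile) :=
  recurrentClosingWeak_iff_singularForcesRdss.symm.trans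
    (recurrentClosingWeak_iff_rdssLiouville_imp.trans
      (imp_congr_right fun _ => typeIAncientLiouville_iff_noTypeIRateProfile))

end Summit.NavierStokesRegularity.NavierStokesRegularity.Theorems.SymmetryModuliCountForcedSymmetry

end
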